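import Literature.Probability.RandomPlanarGeometry.SLEBubblesClosedFillLaw
import Literature.Probability.RandomPlanarGeometry.RestrictionMeasuresFiveEighthsThreeLeaves
import Literature.Probability.RandomPlanarGeometry.RestrictionMeasuresFiveEighthsInteriorHolds
import Literature.Probability.RandomPlanarGeometry.ConformalRestrictionThreeLeaves
import Literature.Probability.RandomPlanarGeometry.RestrictionMeasuresExistence
import HarnessLib

/-!
# [LSW] p. 5 results 1–2, Cor. 8.6, Prop. 8.1 and the `α > 5/8` leaf from TWO leaves — a Brownian bubble measure and Theorem 6.5 — without `SLEBubbles.exists_measurable_version`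

Proof-only glue (no definition, no named fact), after

* G. F. Lawler, O. Schramm, W. Werner, *Conformal restriction: the chordal case*, J. Amer. Math.
  Soc. **16** (2003) 917–955, arXiv:math/0209343 (**[LSW]**), Thm. 7.3 (p. 29) and the sentence
  after its proof ("for all `α > 5/8`, the measure `P_α` exists and can be constructed by adding
  bubbles with appropriate intensity to SLE_κ with `κ = 6/(2α + 1)`"), p. 5 results 1–2,
  Prop. 3.3 (uniqueness of `P_α`), Prop. 8.1, Cor. 8.6.

So far every §7 consequence in the tree waited on the THREE leaves of Thm. 7.3: a Brownian
bubble measure (`exists_isBrownianBubbleMeasure`, §7.1), `Ξ(κ) ∈ Ω` almost surely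
(`SLEBubbles.ae_mem_restrictionConfigs`, equivalently the measurable version
`SLEBubbles.exists_measurable_version`: the closedness lemma `cl Ξ = Ξ ∪ {0}` of p. 29) and
Theorem 6.5 (`SLEBubbles.lintegral_poissonAvoidance_eq_rpow`), e.g.
`exists_isRestrictionMeasure_of_five_eighths_le_of_three_leaves`, `…_of_three_leaves''`,
`LawlerSchrammWerner2003_of_three_leaves`. By `SLEBubbles.isRestrictionMeasure_map_of_measure_disjoint`
(`SLEBubblesClosedFillLaw`: the closed filling `F^ℝ_ℍ(cl(γ ∪ ⋃ X̂)) ∩ ℍ ⊇ Ξ(κ)` is a measurable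
`Ω`-valued version with law `P_{α_κ}`, from (7.3) alone) the middle leaf DROPS OUT:

* `exists_isRestrictionMeasure_of_five_eighths_le_of_measure_disjoint` — `P_α` exists for every
  `α ≥ 5/8`, from a Brownian bubble measure, the bubble cloud and (7.3)
  (`SLEBubbles.measure_disjoint`); `…_of_two_bubble_leaves` — from `exists_isBrownianBubbleMeasure`
  and Theorem 6.5 only (Kingman's theorem `exists_isPoissonCloud_holds` and
  `SLEBubbles.measure_disjoint_of_thm65` supplied by the tree);
* `exists_isRestrictionMeasure_interior_of_gt_five_eighths_of_measure_disjoint` — for `α > 5/8`,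
  the law of the version `Kc ⊇ Ξ(κ(α))` is a `P_α` with interior points almost surely, given a
  bubble measure WITH interior points (the construction of p. 29 itself);
* from bare existence above `5/8` (`…_of_forall_gt`, `RestrictionMeasuresFiveEighthsInteriorHolds`;
  `…_of_thm73`, `RestrictionMeasuresFiveEighthsThreeLeaves`), the TWO-LEAF forms
  `exists_isRestrictionMeasure_ae_interior_nonempty_of_two_bubble_leaves`,
  `IsRestrictionMeasure.ae_interior_nonempty_of_gt_five_eighths_of_two_bubble_leaves` (the
  `α > 5/8` leaf), `exists_isRightRestrictionMeasure_of_two_bubble_leaves` (Prop. 8.1),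
  `exists_isRightRestrictionMeasure_lt_five_eighths_of_two_bubble_leaves`,
  `not_exists_isRestrictionMeasure_of_lt_five_eighths_of_two_bubble_leaves` (Cor. 8.6),
  `exists_isRestrictionMeasure_iff_of_two_bubble_leaves` (p. 5 result 1),
  `IsRestrictionMeasure.eq_five_eighths_of_outer_simple_of_two_bubble_leaves` /
  `…_of_simple_of_two_bubble_leaves` (p. 5 result 2, first sentence) and
  `LawlerSchrammWerner2003_unique_of_two_bubble_leaves` (the uniqueness clause of p. 5 result 2).
  (`LawlerSchrammWerner2003` itself — p. 5 result 2 transposed — is meanwhile an UNCONDITIONAL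
  theorem of the tree, `LawlerSchrammWerner2003_brownianQuad` of `BrownianExcursionRestriction`,
  via the `P_1` of [LSW] §4; no two-leaf form of it is kept here.)

So the discharges of `LawlerSchrammWerner2003_unique`,
`exists_isRestrictionMeasure_iff`, `IsRestrictionMeasure.eq_five_eighths_of_(outer_)simple`,
`not_exists_isRestrictionMeasure_of_lt_five_eighths`, `exists_isRightRestrictionMeasure(_lt_five_eighths)`,
`IsRestrictionMeasure.ae_interior_nonempty_of_gt_five_eighths` and
`exists_isRestrictionMeasure_ae_interior_nonempty` are these theorems applied to
`exists_isBrownianBubbleMeasure_holds` and `SLEBubbles.lintegral_poissonAvoidance_eq_rpow_holds`,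
once they exist; `SLEBubbles.exists_measurable_version` / `SLEBubbles.ae_mem_restrictionConfigs`
are needed by nothing in this cone any more.

Mathlib: none beyond the imports.
-/

noncomputable section

open Set Filter Topology MeasureTheory Metric Bornology
open UpperHalfPlane (upperHalfPlaneSet isOpen_upperHalfPlaneSet)
open scoped NNReal ENNReal
open Literature.Probability.Process (preWienerMeasure IsPoissonCloud exists_isPoissonCloud
  exists_isPoissonCloud_holds)

namespace Literature.Probability.RandomPlanarGeometry

/-! ### Existence of `P_α`, `α ≥ 5/8`, from (7.3) -/

section Existence

/-- **Existence of `P_α` for `α ≥ 5/8`** ([LSW] p. 5 result 1, "if" half above `5/8`, via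
Thm. 7.3 p. 29), from a Brownian bubble measure (`hμex`, §7.1), the bubble cloud (`hcl`, §7.2)
and (7.3) alone (`h₂`): the law of the `Ω`-valued version of the closed filling of `Ξ(κ(α))`,
`κ(α) = 6/(2α + 1) ∈ (0, 8/3]`, is `P_α`. Compare
`exists_isRestrictionMeasure_of_five_eighths_le_of_bubbles` (`RestrictionMeasuresExistence`),
which also needed `SLEBubbles.exists_measurable_version`.
[cite: LawlerSchrammWerner2003Restriction, Thm. 7.3 (p. 29) with p. 5 result 1] -/
theorem exists_isRestrictionMeasure_of_five_eighths_le_of_measure_disjoint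
    (hμex : exists_isBrownianBubbleMeasure) (hcl : SLEBubbles.exists_cloud)
    (h₂ : SLEBubbles.measure_disjoint) {α : ℝ} (hα : 5 / 8 ≤ α) :
    ∃ P : Measure RestrictionConfig, IsRestrictionMeasure α P := by
  obtain ⟨μ, hμ⟩ := hμex
  have hα0 : 0 ≤ α := by linarith
  obtain ⟨Ω', _, P', X, hX⟩ := hcl hμ (sleKappaOfExponent α)
  obtain ⟨Kc, -, -, -, hP⟩ := SLEBubbles.isRestrictionMeasure_map_of_measure_disjoint h₂
    (sleKappaOfExponent_pos hα0) (sleKappaOfExponent_le hα) hμ hX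
  rw [sleBubbleExponent_sleKappaOfExponent hα0] at hP
  exact ⟨_, hP⟩

/-- The same with the cloud supplied by **Kingman's existence theorem**
(`SLEBubbles.exists_cloud_of_exists_isPoissonCloud`). [cite: LawlerSchrammWerner2003Restriction, Thm. 7.3 (p. 29) with §7.2 (p. 28)] -/
theorem exists_isRestrictionMeasure_of_five_eighths_le_of_measure_disjoint'
    (hμex : exists_isBrownianBubbleMeasure) (hK : exists_isPoissonCloud.{0})
    (h₂ : SLEBubbles.measure_disjoint) {α : ℝ} (hα : 5 / 8 ≤ α) :
    ∃ P : Measure RestrictionConfig, IsRestrictionMeasure α P :=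
  exists_isRestrictionMeasure_of_five_eighths_le_of_measure_disjoint hμex
    (SLEBubbles.exists_cloud_of_exists_isPoissonCloud hK) h₂ hα

/-- **Existence of `P_α`, `α ≥ 5/8`, from the TWO leaves**: a Brownian bubble measure (`hμex`)
and Theorem 6.5 (`h65`) — Kingman's theorem (`exists_isPoissonCloud_holds`) and (7.3) from
Thm. 6.5 (`SLEBubbles.measure_disjoint_of_thm65`) being theorems of the tree. Compare
`exists_isRestrictionMeasure_of_five_eighths_le_of_three_leaves` (`RestrictionMeasuresExistenceHolds`).
[cite: LawlerSchrammWerner2003Restriction, Thm. 7.3 (p. 29) with §7.1–7.2 (pp. 27–28)] -/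
theorem exists_isRestrictionMeasure_of_five_eighths_le_of_two_bubble_leaves
    (hμex : exists_isBrownianBubbleMeasure) (h65 : SLEBubbles.lintegral_poissonAvoidance_eq_rpow)
    {α : ℝ} (hα : 5 / 8 ≤ α) : ∃ P : Measure RestrictionConfig, IsRestrictionMeasure α P :=
  exists_isRestrictionMeasure_of_five_eighths_le_of_measure_disjoint' hμex exists_isPoissonCloud_holds
    (SLEBubbles.measure_disjoint_of_thm65 h65) hα

/-- **Existence of `P_α` with interior points for `α > 5/8`, by the construction of p. 29**
("for all `α > 5/8`, the measure `P_α` exists and can be constructed by adding bubbles with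
appropriate intensity to SLE_κ with `κ = 6/(2α + 1)`. The frontier of the set defined under
`P_α` has Hausdorff dimension `4/3` (because of the Brownian bubbles)"), from a Brownian bubble
measure WITH interior points (`hμex`), Kingman's existence theorem (`hK`) and (7.3) (`h₂`): the
law of the `Ω`-valued version `Kc ⊇ Ξ(κ(α))` is `P_α`, and `Ξ`, hence `Kc`, a.s. has an
interior point (`SLEBubbles.ae_interior_nonempty_of_measure`). (For the bare `α > 5/8` leaf the
interior property of the bubbles is not needed: `…_of_two_bubble_leaves` below.)
[cite: LawlerSchrammWerner2003Restriction, Thm. 7.3 and p. 29] -/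
theorem exists_isRestrictionMeasure_interior_of_gt_five_eighths_of_measure_disjoint
    (hμex : exists_isBrownianBubbleMeasure_ae_interior_nonempty) (hK : exists_isPoissonCloud.{0})
    (h₂ : SLEBubbles.measure_disjoint) {α : ℝ} (hα : 5 / 8 < α) :
    ∃ P : Measure RestrictionConfig, IsRestrictionMeasure α P ∧
      ∀ᵐ K : RestrictionConfig ∂P, (interior (K : Set ℂ)).Nonempty := by
  obtain ⟨μ, hμ, hμint⟩ := hμex
  have hα0 : 0 ≤ α := by linarith
  set κ := sleKappaOfExponent α with hκdef
  have hκ0 : 0 < κ := sleKappaOfExponent_pos hα0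
  have hκlt : κ < 8 / 3 := sleKappaOfExponent_lt hα
  obtain ⟨Ω', _, P', X, hX⟩ := SLEBubbles.exists_cloud_of_exists_isPoissonCloud hK hμ κ
  obtain ⟨Kc, hKc, hsub, -, hP⟩ :=
    SLEBubbles.isRestrictionMeasure_map_of_measure_disjoint h₂ hκ0 hκlt.le hμ hX
  rw [hκdef, sleBubbleExponent_sleKappaOfExponent hα0] at hP
  refine ⟨_, hP, RestrictionConfig.ae_map_interior_nonempty hKc ?_⟩
  filter_upwards [hsub, SLEBubbles.ae_interior_nonempty_of_measure hκ0 hκlt hμ hμint hX] with p hp hi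
  exact hi.mono (interior_mono hp)

end Existence

/-! ### Everything downstream from the two leaves -/

section TwoLeaves

/-- **The existential interior form of Thm. 7.3** (`exists_isRestrictionMeasure_ae_interior_nonempty`:
for `α > 5/8` some `P_α` is carried by configurations with interior points) from the two leaves,
through bare existence above `5/8` (`exists_isRestrictionMeasure_ae_interior_nonempty_of_forall_gt`:
positivity by the one-sided squeeze, almost sureness by the zero–one law).
[cite: LawlerSchrammWerner2003Restriction, Thm. 7.3 (p. 29) and p. 4] -/
theorem exists_isRestrictionMeasure_ae_interior_nonempty_of_two_bubble_leaves
    (hμex : exists_isBrownianBubbleMeasure) (h65 : SLEBubbles.lintegral_poissonAvoidance_eq_rpow) :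
    exists_isRestrictionMeasure_ae_interior_nonempty :=
  exists_isRestrictionMeasure_ae_interior_nonempty_of_forall_gt fun _ hα ↦
    exists_isRestrictionMeasure_of_five_eighths_le_of_two_bubble_leaves hμex h65 hα.le

/-- **The `α > 5/8` leaf** `IsRestrictionMeasure.ae_interior_nonempty_of_gt_five_eighths`
(`P_α`-a.e. configuration has an interior point, `α > 5/8`) from the two leaves. Compare
`…_of_three_leaves''` (`RestrictionMeasuresFiveEighthsInteriorHolds`).
[cite: LawlerSchrammWerner2003Restriction, p. 4 and Thm. 7.3 (p. 29)] -/
theorem IsRestrictionMeasure.ae_interior_nonempty_of_gt_five_eighths_of_two_bubble_leaves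
    (hμex : exists_isBrownianBubbleMeasure) (h65 : SLEBubbles.lintegral_poissonAvoidance_eq_rpow) :
    IsRestrictionMeasure.ae_interior_nonempty_of_gt_five_eighths :=
  IsRestrictionMeasure.ae_interior_nonempty_of_gt_five_eighths_of_forall_gt fun _ hα ↦
    exists_isRestrictionMeasure_of_five_eighths_le_of_two_bubble_leaves hμex h65 hα.le

/-- **[LSW] Prop. 8.1** (`exists_isRightRestrictionMeasure`: `P⁺_α` exists for all `α > 0`)
from the two leaves (`exists_isRightRestrictionMeasure_of_thm73`).
[cite: LawlerSchrammWerner2003Restriction, Prop. 8.1 (§8.2) with Thm. 7.3 (p. 29)] -/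
theorem exists_isRightRestrictionMeasure_of_two_bubble_leaves
    (hμex : exists_isBrownianBubbleMeasure) (h65 : SLEBubbles.lintegral_poissonAvoidance_eq_rpow) :
    exists_isRightRestrictionMeasure :=
  exists_isRightRestrictionMeasure_of_thm73
    (exists_isRestrictionMeasure_ae_interior_nonempty_of_two_bubble_leaves hμex h65)

/-- **The Cor. 8.6 input** `exists_isRightRestrictionMeasure_lt_five_eighths` from the two
leaves (`exists_isRightRestrictionMeasure_lt_five_eighths_of_thm73`).
[cite: LawlerSchrammWerner2003Restriction, Cor. 8.6 (pp. 37–38) with Thm. 7.3 (p. 29); Lawler2005, Cor. 9.11] -/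
theorem exists_isRightRestrictionMeasure_lt_five_eighths_of_two_bubble_leaves
    (hμex : exists_isBrownianBubbleMeasure) (h65 : SLEBubbles.lintegral_poissonAvoidance_eq_rpow) :
    exists_isRightRestrictionMeasure_lt_five_eighths :=
  exists_isRightRestrictionMeasure_lt_five_eighths_of_thm73
    (exists_isRestrictionMeasure_ae_interior_nonempty_of_two_bubble_leaves hμex h65)

/-- **[LSW] Cor. 8.6** ("for all `α < 5/8`, `P_α` does not exist") from the two leaves
(`not_exists_isRestrictionMeasure_of_lt_five_eighths_of_thm73`).
[cite: LawlerSchrammWerner2003Restriction, Cor. 8.6 (pp. 37–38) with Thm. 7.3 (p. 29)] -/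
theorem not_exists_isRestrictionMeasure_of_lt_five_eighths_of_two_bubble_leaves
    (hμex : exists_isBrownianBubbleMeasure) (h65 : SLEBubbles.lintegral_poissonAvoidance_eq_rpow) :
    not_exists_isRestrictionMeasure_of_lt_five_eighths :=
  not_exists_isRestrictionMeasure_of_lt_five_eighths_of_thm73
    (exists_isRestrictionMeasure_ae_interior_nonempty_of_two_bubble_leaves hμex h65)

/-- **[LSW] p. 5 result 1** (`exists_isRestrictionMeasure_iff`: for `α > 0`, `P_α` exists iff
`α ≥ 5/8`) from the two leaves (`exists_isRestrictionMeasure_iff_of_thm73`). Compare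
`exists_isRestrictionMeasure_iff_of_three_leaves`.
[cite: LawlerSchrammWerner2003Restriction, p. 5 result 1; Thm. 7.3 (p. 29), Cor. 8.6 (p. 37)] -/
theorem exists_isRestrictionMeasure_iff_of_two_bubble_leaves
    (hμex : exists_isBrownianBubbleMeasure) (h65 : SLEBubbles.lintegral_poissonAvoidance_eq_rpow) :
    exists_isRestrictionMeasure_iff :=
  exists_isRestrictionMeasure_iff_of_thm73
    (exists_isRestrictionMeasure_ae_interior_nonempty_of_two_bubble_leaves hμex h65)

/-- **[LSW] p. 5 result 2, first sentence, outer reading**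
(`IsRestrictionMeasure.eq_five_eighths_of_outer_simple`) from the two leaves: Cor. 8.6 and the
`α > 5/8` leaf above, glued by `IsRestrictionMeasure.eq_five_eighths_of_outer_simple_of_facts`.
Compare `…_of_three_leaves`.
[cite: LawlerSchrammWerner2003Restriction, p. 5 result 2; Thm. 7.3 (p. 29), Cor. 8.6 (pp. 37–38)] -/
theorem IsRestrictionMeasure.eq_five_eighths_of_outer_simple_of_two_bubble_leaves
    (hμex : exists_isBrownianBubbleMeasure) (h65 : SLEBubbles.lintegral_poissonAvoidance_eq_rpow) :
    IsRestrictionMeasure.eq_five_eighths_of_outer_simple :=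
  IsRestrictionMeasure.eq_five_eighths_of_outer_simple_of_facts
    (not_exists_isRestrictionMeasure_of_lt_five_eighths_of_two_bubble_leaves hμex h65)
    (IsRestrictionMeasure.ae_interior_nonempty_of_gt_five_eighths_of_two_bubble_leaves hμex h65)

/-- The almost-everywhere reading (`IsRestrictionMeasure.eq_five_eighths_of_simple`) from the two
leaves. [cite: LawlerSchrammWerner2003Restriction, p. 5 result 2; Thm. 7.3 (p. 29), Cor. 8.6 (pp. 37–38)] -/
theorem IsRestrictionMeasure.eq_five_eighths_of_simple_of_two_bubble_leaves
    (hμex : exists_isBrownianBubbleMeasure) (h65 : SLEBubbles.lintegral_poissonAvoidance_eq_rpow) :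
    IsRestrictionMeasure.eq_five_eighths_of_simple :=
  IsRestrictionMeasure.eq_five_eighths_of_simple_of_outer
    (IsRestrictionMeasure.eq_five_eighths_of_outer_simple_of_two_bubble_leaves hμex h65)

/-- **The uniqueness clause `LawlerSchrammWerner2003_unique` from the two leaves**
(`LawlerSchrammWerner2003_unique_of_five_eighths`: Lemma 3.2, Prop. 3.3 and the slit Loewner
theorem are theorems of the tree). Compare `LawlerSchrammWerner2003_unique_of_four_leaves`.
[cite: LawlerSchrammWerner2003Restriction, p. 5 result 2; Lemma 3.2 (p. 10), Prop. 3.3 (pp. 10–13), Thm. 7.3 (p. 29), Cor. 8.6 (pp. 37–38)] -/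
theorem LawlerSchrammWerner2003_unique_of_two_bubble_leaves
    (hμex : exists_isBrownianBubbleMeasure) (h65 : SLEBubbles.lintegral_poissonAvoidance_eq_rpow) :
    LawlerSchrammWerner2003_unique :=
  LawlerSchrammWerner2003_unique_of_five_eighths
    (IsRestrictionMeasure.eq_five_eighths_of_outer_simple_of_two_bubble_leaves hμex h65)

end TwoLeaves

end Literature.Probability.RandomPlanarGeometry

end
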